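import Summits.QuantumFields.BalabanUV.T4Continuum.Support.NE7SliceInduction
import Summits.QuantumFields.BalabanUV.T4Continuum.Support.NE7StraightDatumTorus
import Summits.QuantumFields.BalabanUV.T4Continuum.Support.NE7LandauNewtonLimit
import HarnessLib

/-!
# NE7TopLandauGauge — THE SUP HALF OF ROAD v4, DOCKED: in the fibre `cavgIter L (k+1) U = 1` of a unitary `(L^{k+1}N)`-periodic field with plaquettes `ε`-close to `1` there is,
# as soon as `M²ε ≤ θ₁` (`M = L^{k+1}`), a unitary periodic gauge `u₀` with EVERY link `‖U^{u₀} − 1‖ ≤ C₀·M·ε` AND `log U^{u₀}` EXACTLY in Bałaban's linear Landau gauge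
# `(1 − P)∂* = 0` on lit-balaban's torus (entrywise), `‖log U^{u₀}‖ ≤ C₁·M·ε`, straight averages `≤ C₂·M·ε`; `C₀, C₁, C₂, θ₁ > 0` depend on `d`, `card n`, `L` only
# (`NE7TopLandauGauge`)

Cell `pub-balaban`, lineage `t4-ne7-p1` (CRUX PROVER NE7 #1 = OWNER of row NE7), gen 74; memo `t4/b2b-balaban-t4-ne7-p1-g74/REP-FLAT-ROAD-v4.md` §3 (docking D4).  BY NAME:
gen 73's v2 END `NE7SliceInduction.exists_pinned_sup_gauge` (the pinned sup gauge `g`, links `a = C·M·ε`, flat top kept), gen 73's S2 chart `NE7SliceStepNonlinear.logChart_data`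
at the top with the trivial gauge (the comb datum of `log U^{g}` is `≤ C₂′(2Ma)²` since the top average is flat), gen 74's T1 `NE7StraightDatumTorus.norm_qvOp_entry_le_dirIter`
(⇒ straight datum `q₀ = O(δ∕M)`), and T4c `NE7LandauNewtonLimit.exists_top_landau_gauge` with `n₀ = M`, whose mass `m₀ = M·2a + M²(ε + 32(2a)²) + M q₀` is `≤ c_m·δ`,
`δ = M²ε` — so its ONE smallness line is `δ ≤ θ₁`, uniformly in `k` and `N`.  The output gauge is `u₀ = u·g`.  This is G7's binder `hr₀` (`NE7ApeTrivialFlatEndLinks`) with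
`r₀ = C₀δ∕M`, now in an EXACT gauge — the input of the gradient letter (T5).
CONTENT ([folklore]; 0 def, 0 sorry; dimension `d + 1`, `L ≥ 2`).  **`exists_top_landau_gauge_flatTop`**.
HONEST FRAMING (page 1): OUR road ([B5]'s linear Landau gauge iterated at the flat background after v2's pinned sup induction); [B8] Prop. 5 ∕ Thm 2 (curved backgrounds, full
(1.36)–(1.39) ladder) are NOT claimed; REP♭'s GRADIENT member is NOT here; (APE) NOT proved; NE7 NOT PRINTED ∕ NOT PROVED (0∕1); spine PROVED 0∕9; rung (B)+1 finite T⁴ —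
NOT infinite volume, NOT mass gap, NOT BetaPertH, NOT Clay.  PLACEMENT: our lemma, under `Summits/QuantumFields/BalabanUV/`.
Continuum YM on T⁴ ⇐ BetaPertH ∧ nine spine estimates (0/9 proved); BetaPertH ⇐ (D1) ∧ (D4) ∧ CAP+tail; G-an2-4 gates asym, D1 and NE2/3/4.
-/

set_option autoImplicit false

open scoped BigOperators Matrix Matrix.Norms.L2Operator
open NormedSpace Finset

namespace Summit.QuantumFields.BalabanUV.T4Continuum.NE7TopLandauGauge

open Literature.MathematicalPhysics.QuantumFieldTheory.Balaban1983to89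
open B7Prop1Explicit B7Prop2Explicit MatrixLog
open T4AveragingDeficitWall (IsUnitaryCfg IsSkewDir SmallField)
open T4AveragingDeficitWallBoundary (IsPeriodicCfg)
open AveragingDeficitPeriodicCounting (IsPeriodicDir)
open AveragingDeficitTwoLevelPrep (twoLevelSmall)
open AveragingDeficitMultiLevelPrep (cavgIter LevelSmall)
open AveragingDeficitKDatum (isUnitaryCfg_gaugeAct)
open BlockAveragePushDirSplit (flat)
open BlockAverageVaryDisc (rho0 rho0_pos)
open BlockAverageCurrent (smallField_gaugeAct)
open NE3EnergyShapes (IsUnitarySite IsPeriodicSite gaugeAct_one)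
open NE3ResidualSliceRep (isPeriodicCfg_gaugeAct)
open NE3ClassRadiusFamily (levelSmall_of_small)
open NE3TangentCovariantTower (dirIter)
open B5Prop11Plancherel (Tor fine)
open B5Action121 (GradOp)
open B5Block118 (QvOp)
open B5Value126 (PcT)
open B6LowerBound2153Torus (rep)
open B7BlockAvgLog (mlog_exp)
open NE7SliceInduction (exists_pinned_sup_gauge)
open NE7SliceStepNonlinear (logChart_data)
open NE7StraightDatumTorus (norm_qvOp_entry_le_dirIter)
open NE7LandauNewtonLimit (exists_top_landau_gauge)

noncomputable section

variable {d : ℕ} {n : Type} [Fintype n] [DecidableEq n]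

-- one bookkeeping theorem over four existential packages; the default heartbeat budget does not suffice (precedent: `AveragingDeficitDerivAssembly`)
set_option maxHeartbeats 800000 in
/-- **THE TOP LANDAU GAUGE IN THE FLAT FIBRE, k- AND N-UNIFORMLY** (see the module docstring). [folklore] -/
theorem exists_top_landau_gauge_flatTop [Nonempty n] {L : ℕ} (hL : 2 ≤ L) :
    ∃ C₀ C₁ C₂ θ₁ : ℝ, 0 < C₀ ∧ 0 < C₁ ∧ 0 < C₂ ∧ 0 < θ₁ ∧ ∀ (k N : ℕ) [NeZero N] [NeZero (L ^ (k + 1))]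
      (U : Site (d + 1) → Fin (d + 1) → (Matrix n n ℂ)ˣ) (ε : ℝ),
      IsUnitaryCfg U → 0 ≤ ε → SmallField U ε → IsPeriodicCfg U ((L ^ (k + 1) * N : ℕ) : ℤ) → cavgIter L (k + 1) U = flat →
      ((L : ℝ) ^ (k + 1)) ^ 2 * ε ≤ θ₁ →
      ∃ u₀ : Site (d + 1) → (Matrix n n ℂ)ˣ, IsUnitarySite u₀ ∧ IsPeriodicSite u₀ ((L ^ (k + 1) * N : ℕ) : ℤ) ∧
        (∀ (y : Site (d + 1)) (κ : Fin (d + 1)), ‖((gaugeAct u₀ U y κ : (Matrix n n ℂ)ˣ) : Matrix n n ℂ) - 1‖ ≤ C₀ * (L : ℝ) ^ (k + 1) * ε) ∧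
        (∀ j j' : n, (1 - PcT (L ^ (k + 1)) (fun _ : Fin (d + 1) => N) ((L ^ (k + 1) : ℕ) : ℂ)) *ᵥ
          ((GradOp (fine (L ^ (k + 1)) (fun _ : Fin (d + 1) => N)) ((L ^ (k + 1) : ℕ) : ℂ))ᴴ *ᵥ
            fun p : Tor (fine (L ^ (k + 1)) (fun _ : Fin (d + 1) => N)) × Fin (d + 1) =>
              mlog ((gaugeAct u₀ U (rep (fine (L ^ (k + 1)) (fun _ : Fin (d + 1) => N)) p.1) p.2 : (Matrix n n ℂ)ˣ) : Matrix n n ℂ) j j') = 0) ∧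
        (∀ (y : Site (d + 1)) (κ : Fin (d + 1)), ‖mlog ((gaugeAct u₀ U y κ : (Matrix n n ℂ)ˣ) : Matrix n n ℂ)‖ ≤ C₁ * (L : ℝ) ^ (k + 1) * ε) ∧
        (∀ (j j' : n) (t : Tor (fun _ : Fin (d + 1) => N)) (κ : Fin (d + 1)),
          ‖(QvOp (L ^ (k + 1)) (fun _ : Fin (d + 1) => N) *ᵥ fun p : Tor (fine (L ^ (k + 1)) (fun _ : Fin (d + 1) => N)) × Fin (d + 1) =>
            mlog ((gaugeAct u₀ U (rep (fine (L ^ (k + 1)) (fun _ : Fin (d + 1) => N)) p.1) p.2 : (Matrix n n ℂ)ˣ) : Matrix n n ℂ) j j') (t, κ)‖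
            ≤ C₂ * (L : ℝ) ^ (k + 1) * ε) := by
  letI : CStarAlgebra (Matrix n n ℂ) := {}
  have hL1 : 1 ≤ L := by omega
  have hL1r : (1 : ℝ) ≤ L := by exact_mod_cast hL1
  -- the constants
  obtain ⟨C, θ₀, hC, hθ₀, hEND⟩ := exists_pinned_sup_gauge (d := d) (n := n) hL
  obtain ⟨K, K', hK, hK', hTOP⟩ := exists_top_landau_gauge (d := d) (n := n)
  obtain ⟨D, hDdef⟩ : ∃ D : ℝ, D = ((d + 1 : ℕ) : ℝ) := ⟨_, rfl⟩
  have hD1 : 1 ≤ D := by rw [hDdef]; exact_mod_cast Nat.succ_le_succ (Nat.zero_le d)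
  have hD0 : 0 ≤ D := by linarith
  have hρ0 : 0 < rho0 (d + 1) L := rho0_pos hL1
  obtain ⟨C₂', hC₂'⟩ : ∃ C₂' : ℝ, C₂' = 4 * (3 + 12 * D) ^ 3 / rho0 (d + 1) L ^ 2 := ⟨_, rfl⟩
  have hC₂'0 : 0 ≤ C₂' := by rw [hC₂']; positivity
  obtain ⟨ct, hct⟩ : ∃ ct : ℝ, ct = D * (Fintype.card n + K + K') := ⟨_, rfl⟩
  obtain ⟨cδ, hcδ⟩ : ∃ cδ : ℝ, cδ = 1 + K + K' := ⟨_, rfl⟩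
  obtain ⟨cr, hcr⟩ : ∃ cr : ℝ, cr = 4 * (K + K') + 1 + 8 * (ct + cδ) * cδ := ⟨_, rfl⟩
  have hct0 : 0 ≤ ct := by rw [hct]; positivity
  have hcδ0 : 0 ≤ cδ := by rw [hcδ]; positivity
  have hcr0 : 0 ≤ cr := by rw [hcr]; positivity
  obtain ⟨Θ, hΘ⟩ : ∃ Θ : ℝ, Θ = 80 * cr + 40 * ct + 40 * cδ + 8 * (ct + cδ) * (2 * cr + cδ) + 2 * (4 * ct + 128 * cr * (cδ + 1 / 2)) := ⟨_, rfl⟩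
  have hΘ0 : 0 ≤ Θ := by rw [hΘ]; positivity
  obtain ⟨cm, hcm⟩ : ∃ cm : ℝ, cm = 2 * C + 1 + 4 * D * C + 128 * C ^ 2 + 4 * C₂' * C ^ 2 := ⟨_, rfl⟩
  have hcm0 : 0 < cm := by rw [hcm]; positivity
  obtain ⟨A₁, hA₁⟩ : ∃ A₁ : ℝ, A₁ = 14464 * (D + 1) ^ 2 * (D + 4) ^ 2 * (8 / 3) := ⟨_, rfl⟩
  obtain ⟨A₂, hA₂⟩ : ∃ A₂ : ℝ, A₂ = 2 * twoLevelSmall (d + 1) L := ⟨_, rfl⟩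
  have hA₂0 : 0 ≤ A₂ := by rw [hA₂]; unfold twoLevelSmall; positivity
  obtain ⟨Q, hQ⟩ : ∃ Q : ℝ, Q = 128 * C + 8 * (3 + 12 * D) ^ 2 * C / rho0 (d + 1) L ^ 2 + 2 * A₁ + A₂ + Θ * cm := ⟨_, rfl⟩
  have hA₁0 : 0 ≤ A₁ := by rw [hA₁]; positivity
  have hQ0 : 0 ≤ Q := by rw [hQ]; positivity
  obtain ⟨θ₁, hθ₁⟩ : ∃ θ₁ : ℝ, θ₁ = min θ₀ (min 1 (1 / (Q + 1))) := ⟨_, rfl⟩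
  have hθ₁0 : 0 < θ₁ := by rw [hθ₁]; exact lt_min hθ₀ (lt_min one_pos (by positivity))
  refine ⟨cr * cm, 2 * (K + K') * cm, 2 * cm, θ₁, mul_pos (by linarith [hcr0, show (1:ℝ) ≤ cr by rw [hcr]; nlinarith [mul_nonneg (mul_nonneg (by norm_num : (0:ℝ) ≤ 8) (add_nonneg hct0 hcδ0)) hcδ0]]) hcm0,
    by positivity, by positivity, hθ₁0, ?_⟩
  intro k N _ _ U ε hUu hε hUε hUP hflat hθ
  obtain ⟨M, hMdef⟩ : ∃ M : ℝ, M = (L : ℝ) ^ (k + 1) := ⟨_, rfl⟩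
  have hM1 : 1 ≤ M := by rw [hMdef]; exact one_le_pow₀ hL1r
  have hM0 : 0 < M := by linarith
  have hMn : ((L ^ (k + 1) : ℕ) : ℝ) = M := by rw [hMdef]; push_cast; ring
  obtain ⟨δ, hδdef⟩ : ∃ δ : ℝ, δ = M ^ 2 * ε := ⟨_, rfl⟩
  have hδ0 : 0 ≤ δ := by rw [hδdef]; positivity
  have hθ' : δ ≤ min θ₀ (min 1 (1 / (Q + 1))) := by rw [hδdef, hMdef, ← hθ₁]; exact hθ
  have hδθ₀ : δ ≤ θ₀ := hθ'.trans (min_le_left _ _)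
  have hδ1 : δ ≤ 1 := hθ'.trans ((min_le_right _ _).trans (min_le_left _ _))
  have hδQ : δ * (Q + 1) ≤ 1 := by
    have h := hθ'.trans ((min_le_right _ _).trans (min_le_right _ _))
    rwa [le_div_iff₀ (by positivity)] at h
  -- each smallness requirement `c·δ ≤ 1` with `c ≤ Q`
  have hreq : ∀ c : ℝ, 0 ≤ c → c ≤ Q → c * δ ≤ 1 := fun c hc hcQ => by nlinarith
  have hQ1 : 0 ≤ 8 * (3 + 12 * D) ^ 2 * C / rho0 (d + 1) L ^ 2 := by positivity
  have hQ2 : 0 ≤ Θ * cm := mul_nonneg hΘ0 hcm0.le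
  have hR3 : 128 * C * δ ≤ 1 := hreq _ (by positivity) (by rw [hQ]; linarith)
  have hR4 : 8 * (3 + 12 * D) ^ 2 * C / rho0 (d + 1) L ^ 2 * δ ≤ 1 := hreq _ hQ1 (by rw [hQ]; linarith)
  have hR5b : A₂ * δ ≤ 1 := hreq _ hA₂0 (by rw [hQ]; linarith)
  have hR6 : Θ * cm * δ ≤ 1 := hreq _ hQ2 (by rw [hQ]; linarith)
  have hA₁δ : A₁ * δ ≤ 1 / 2 := by
    have h := hreq _ (by positivity : (0:ℝ) ≤ 2 * A₁) (by rw [hQ]; linarith)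
    linarith
  -- v2's pinned sup gauge
  obtain ⟨g, hgu, hgP, -, hgflat, hglinks⟩ := hEND k N U ε hUu hε hUε hUP hflat (by rw [hδdef, hMdef] at hδθ₀; exact hδθ₀)
  obtain ⟨V, hVdef⟩ : ∃ V : Site (d + 1) → Fin (d + 1) → (Matrix n n ℂ)ˣ, V = gaugeAct g U := ⟨_, rfl⟩
  have hVu : IsUnitaryCfg V := by rw [hVdef]; exact isUnitaryCfg_gaugeAct hgu hUu
  have hVP : IsPeriodicCfg V ((L ^ (k + 1) * N : ℕ) : ℤ) := by rw [hVdef]; exact isPeriodicCfg_gaugeAct hgP hUP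
  have hVε : SmallField V ε := by rw [hVdef]; exact smallField_gaugeAct hgu hUε
  obtain ⟨a, hadef⟩ : ∃ a : ℝ, a = C * M * ε := ⟨_, rfl⟩
  have ha0 : 0 ≤ a := by rw [hadef]; exact mul_nonneg (mul_nonneg hC.le hM0.le) hε
  have haδ : M * a = C * δ := by rw [hadef, hδdef]; ring
  have ha : ∀ (y : Site (d + 1)) (κ : Fin (d + 1)), ‖((V y κ : (Matrix n n ℂ)ˣ) : Matrix n n ℂ) - 1‖ ≤ a := fun y κ => by
    have h := hglinks y κ
    rw [← hMdef, ← hadef, ← hVdef] at h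
    exact h
  have haM : a ≤ C * δ := by
    calc a = 1 * a := (one_mul a).symm
      _ ≤ M * a := mul_le_mul_of_nonneg_right hM1 ha0
      _ = C * δ := haδ
  have ha128 : a ≤ 1 / 128 := by nlinarith
  -- the multi-level class of `ε`
  have hLsq : (1 : ℝ) ≤ (L : ℝ) ^ 2 := one_le_pow₀ hL1r
  have hθk : ((L : ℝ) ^ 2) ^ k * ε ≤ δ := by
    have h1 : ((L : ℝ) ^ 2) ^ k * ε ≤ ((L : ℝ) ^ 2) ^ (k + 1) * ε := mul_le_mul_of_nonneg_right (pow_le_pow_right₀ hLsq (Nat.le_succ k)) hε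
    have h2 : ((L : ℝ) ^ 2) ^ (k + 1) * ε = δ := by rw [hδdef, hMdef]; ring
    linarith
  have hs : LevelSmall (d + 1) L k ε := by
    refine levelSmall_of_small (d := d + 1) hL k hε ?_ ?_
    · have hk : (L : ℝ) ^ 2 * (((L : ℝ) ^ 2) ^ k * ε) = δ := by rw [hδdef, hMdef]; ring
      calc 14464 * (((d + 1 : ℕ) : ℝ) + 1) ^ 2 * (((d + 1 : ℕ) : ℝ) + 4) ^ 2 * (L : ℝ) ^ 2 * (8 / 3 * (((L : ℝ) ^ 2) ^ k * ε))
          = A₁ * ((L : ℝ) ^ 2 * (((L : ℝ) ^ 2) ^ k * ε)) := by rw [hA₁, hDdef]; ring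
        _ = A₁ * δ := by rw [hk]
        _ ≤ 1 / 2 := hA₁δ
    · have hA₂0' : 0 ≤ 2 * twoLevelSmall (d + 1) L := by rw [← hA₂]; exact hA₂0
      calc 2 * twoLevelSmall (d + 1) L * (((L : ℝ) ^ 2) ^ k * ε) ≤ 2 * twoLevelSmall (d + 1) L * δ :=
            mul_le_mul_of_nonneg_left hθk hA₂0'
        _ = A₂ * δ := by rw [hA₂]
        _ ≤ 1 := hR5b
  -- the logarithmic chart at the top with the trivial gauge: comb datum of `log V`
  have hσl : 4 * (3 + 12 * ((d + 1 : ℕ) : ℝ)) ^ 2 * (L : ℝ) ^ (k + 1) * (2 * a) ≤ rho0 (d + 1) L ^ 2 := by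
    have h1 : 4 * (3 + 12 * ((d + 1 : ℕ) : ℝ)) ^ 2 * (L : ℝ) ^ (k + 1) * (2 * a) = 8 * (3 + 12 * D) ^ 2 * C * δ := by
      rw [← hDdef, ← hMdef]; linear_combination (8 * (3 + 12 * D) ^ 2) * haδ
    have h2 := hR4
    rw [div_mul_eq_mul_div, div_le_one (by positivity)] at h2
    exact h1.trans_le h2
  have hflat1 : ∀ (z : Site (d + 1)) (κ : Fin (d + 1)), ‖((cavgIter L (k + 1) V z κ : (Matrix n n ℂ)ˣ) : Matrix n n ℂ) - 1‖ ≤ 0 := by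
    intro z κ
    have h : cavgIter L (k + 1) V z κ = 1 := by rw [hVdef, hgflat]
    have h2 : ‖((cavgIter L (k + 1) V z κ : (Matrix n n ℂ)ˣ) : Matrix n n ℂ) - 1‖ = 0 := by rw [h]; simp
    exact h2.le
  obtain ⟨A, hexpA, -, hAP, hAn, -, hdatum⟩ := logChart_data (d := d) (n := n) hL k N (i := k) le_rfl hVu hε hs hVε hVP
    (g := fun _ => (1 : (Matrix n n ℂ)ˣ)) (fun _ => (unitaryUnits _).one_mem) (fun _ _ => rfl) (fun _ => rfl)
    (a := a) (β' := 0) (fun y κ => by rw [gaugeAct_one]; exact ha y κ) hflat1 ha128 (by norm_num) hσl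
  have hper : L ^ (k + 1) * (L ^ (k - k) * N) = L ^ (k + 1) * N := by rw [Nat.sub_self, pow_zero, one_mul]
  rw [hper] at hAP
  have hAeq : ∀ (y : Site (d + 1)) (κ : Fin (d + 1)), mlog ((V y κ : (Matrix n n ℂ)ˣ) : Matrix n n ℂ) = A y κ := by
    intro y κ
    have h := hexpA y κ
    rw [gaugeAct_one] at h
    rw [h]
    exact mlog_exp ((hAn y κ).trans_lt (by linarith [Real.log_two_gt_d9]))
  -- the straight datum of `log V` (T1)
  obtain ⟨q₀, hq₀def⟩ : ∃ q₀ : ℝ, q₀ = (2 * 0 + 4 * (3 + 12 * ((d + 1 : ℕ) : ℝ)) ^ 3 / rho0 (d + 1) L ^ 2 * ((L : ℝ) ^ (k + 1) * (2 * a)) ^ 2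
    + 2 * (((d + 1 : ℕ) : ℝ) * (((L ^ (k + 1) : ℕ) : ℝ) - 1) * (2 * a))) / ((L ^ (k + 1) : ℕ) : ℝ) := ⟨_, rfl⟩
  have hq : ∀ (j j' : n) (t : Tor (fun _ : Fin (d + 1) => N)) (κ : Fin (d + 1)),
      ‖(QvOp (L ^ (k + 1)) (fun _ : Fin (d + 1) => N) *ᵥ fun p : Tor (fine (L ^ (k + 1)) (fun _ : Fin (d + 1) => N)) × Fin (d + 1) =>
        mlog ((V (rep (fine (L ^ (k + 1)) (fun _ : Fin (d + 1) => N)) p.1) p.2 : (Matrix n n ℂ)ˣ) : Matrix n n ℂ) j j') (t, κ)‖ ≤ q₀ := by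
    intro j j' t κ
    have hfun : (fun p : Tor (fine (L ^ (k + 1)) (fun _ : Fin (d + 1) => N)) × Fin (d + 1) =>
        mlog ((V (rep (fine (L ^ (k + 1)) (fun _ : Fin (d + 1) => N)) p.1) p.2 : (Matrix n n ℂ)ˣ) : Matrix n n ℂ) j j')
        = fun p => A (rep (fine (L ^ (k + 1)) (fun _ : Fin (d + 1) => N)) p.1) p.2 j j' := by
      funext p; rw [hAeq]
    rw [hfun, hq₀def]
    exact norm_qvOp_entry_le_dirIter (d := d + 1) hL1 k hAP hdatum hAn j j' t κ
  have hq0 : 0 ≤ q₀ := (norm_nonneg _).trans (hq (Classical.arbitrary n) (Classical.arbitrary n) 0 0)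
  -- the mass `m₀ ≤ c_m·δ`
  obtain ⟨m₀, hm₀def⟩ : ∃ m₀ : ℝ, m₀ = ((L ^ (k + 1) : ℕ) : ℝ) * (2 * a) + ((L ^ (k + 1) : ℕ) : ℝ) ^ 2 * (ε + 32 * (2 * a) ^ 2) + ((L ^ (k + 1) : ℕ) : ℝ) * q₀ :=
    ⟨_, rfl⟩
  have hMq : M * q₀ ≤ 4 * C₂' * C ^ 2 * δ ^ 2 + 4 * D * C * δ := by
    have hM2a : M * (2 * a) = 2 * (C * δ) := by linear_combination 2 * haδ
    have h1 : M * q₀ = 4 * (3 + 12 * ((d + 1 : ℕ) : ℝ)) ^ 3 / rho0 (d + 1) L ^ 2 * (M * (2 * a)) ^ 2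
        + 2 * (((d + 1 : ℕ) : ℝ) * (M - 1) * (2 * a)) := by
      rw [hq₀def, hMn, ← hMdef]
      field_simp
      ring
    rw [← hDdef, ← hC₂', hM2a] at h1
    have h3 : (M - 1) * (2 * a) ≤ 2 * (C * δ) := by
      have e : (M - 1) * (2 * a) = M * (2 * a) - 2 * a := by ring
      rw [e, hM2a]; linarith
    have h2 : D * ((M - 1) * (2 * a)) ≤ D * (2 * (C * δ)) := mul_le_mul_of_nonneg_left h3 hD0
    have e2 : D * (M - 1) * (2 * a) = D * ((M - 1) * (2 * a)) := by ring
    rw [e2] at h1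
    have e3 : C₂' * (2 * (C * δ)) ^ 2 = 4 * C₂' * C ^ 2 * δ ^ 2 := by ring
    linarith
  have hm₀le : m₀ ≤ cm * δ := by
    have h1 : m₀ = 2 * (C * δ) + δ + 128 * (C * δ) ^ 2 + M * q₀ := by rw [hm₀def, hMn, ← haδ, hδdef]; ring
    have hδ2 : δ ^ 2 ≤ δ := by
      calc δ ^ 2 = δ * δ := sq δ
        _ ≤ δ * 1 := mul_le_mul_of_nonneg_left hδ1 hδ0
        _ = δ := mul_one δ
    have p1 : 128 * C ^ 2 * δ ^ 2 ≤ 128 * C ^ 2 * δ := mul_le_mul_of_nonneg_left hδ2 (mul_nonneg (by norm_num) (sq_nonneg C))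
    have p2 : 4 * C₂' * C ^ 2 * δ ^ 2 ≤ 4 * C₂' * C ^ 2 * δ :=
      mul_le_mul_of_nonneg_left hδ2 (mul_nonneg (mul_nonneg (by norm_num) hC₂'0) (sq_nonneg C))
    have e1 : 128 * (C * δ) ^ 2 = 128 * C ^ 2 * δ ^ 2 := by ring
    have h3 : m₀ ≤ (2 * C + 1 + 4 * D * C + 128 * C ^ 2 + 4 * C₂' * C ^ 2) * δ := by
      have e2 : (2 * C + 1 + 4 * D * C + 128 * C ^ 2 + 4 * C₂' * C ^ 2) * δ
          = 2 * (C * δ) + δ + 4 * D * C * δ + 128 * C ^ 2 * δ + 4 * C₂' * C ^ 2 * δ := by ring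
      rw [e2, h1, e1]
      linarith only [hMq, p1, p2]
    calc m₀ ≤ _ := h3
      _ = cm * δ := by rw [hcm]
  have hm₀0 : 0 ≤ m₀ := by rw [hm₀def]; positivity
  have hΘm : Θ * m₀ ≤ 1 := by
    calc Θ * m₀ ≤ Θ * (cm * δ) := mul_le_mul_of_nonneg_left hm₀le hΘ0
      _ = Θ * cm * δ := by ring
      _ ≤ 1 := hR6
  -- T4c
  obtain ⟨u, huU, huP, -, hlinks, hexact, hsup, hstraight⟩ := hTOP (L ^ (k + 1)) N V ε a q₀ m₀ ct cδ cr hVu hVP hε hVε ha0 ha hq0 hq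
    hm₀def (by rw [hct, hDdef]) hcδ hcr (by rw [hΘ] at hΘm; exact hΘm)
  -- the composite gauge `u₀ = u·g`
  have hfac : gaugeAct (fun y => u y * g y) U = gaugeAct u V := by rw [hVdef]; exact B8Eq115GaugeFixing.gaugeAct_mul u g U
  have hrate : m₀ / ((L ^ (k + 1) : ℕ) : ℝ) ≤ cm * ((L : ℝ) ^ (k + 1) * ε) := by
    have h1 : m₀ / ((L ^ (k + 1) : ℕ) : ℝ) = m₀ / M := by rw [hMn]
    have h2 : cm * δ / M = cm * ((L : ℝ) ^ (k + 1) * ε) := by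
      rw [hδdef, hMdef]; field_simp
    calc m₀ / ((L ^ (k + 1) : ℕ) : ℝ) = m₀ / M := h1
      _ ≤ cm * δ / M := div_le_div_of_nonneg_right hm₀le hM0.le
      _ = cm * ((L : ℝ) ^ (k + 1) * ε) := h2
  refine ⟨fun y => u y * g y, fun y => (unitaryUnits _).mul_mem (huU y) (hgu y), fun y ι => by simp only [huP y ι, hgP y ι], fun y κ => ?_,
    fun j j' => ?_, fun y κ => ?_, fun j j' t κ => ?_⟩
  · have h := hlinks y κ
    rw [← hfac] at h
    calc _ ≤ cr * (m₀ / ((L ^ (k + 1) : ℕ) : ℝ)) := h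
      _ ≤ cr * (cm * ((L : ℝ) ^ (k + 1) * ε)) := mul_le_mul_of_nonneg_left hrate hcr0
      _ = cr * cm * (L : ℝ) ^ (k + 1) * ε := by ring
  · have h := hexact j j'
    rw [← hfac] at h
    exact h
  · have h := hsup y κ
    rw [← hfac] at h
    calc _ ≤ 2 * (K + K') * (m₀ / ((L ^ (k + 1) : ℕ) : ℝ)) := h
      _ ≤ 2 * (K + K') * (cm * ((L : ℝ) ^ (k + 1) * ε)) := mul_le_mul_of_nonneg_left hrate (by positivity)
      _ = 2 * (K + K') * cm * (L : ℝ) ^ (k + 1) * ε := by ring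
  · have h := hstraight j j' t κ
    rw [← hfac] at h
    calc _ ≤ 2 * (m₀ / ((L ^ (k + 1) : ℕ) : ℝ)) := h
      _ ≤ 2 * (cm * ((L : ℝ) ^ (k + 1) * ε)) := mul_le_mul_of_nonneg_left hrate (by norm_num)
      _ = 2 * cm * (L : ℝ) ^ (k + 1) * ε := by ring

end

end Summit.QuantumFields.BalabanUV.T4Continuum.NE7TopLandauGauge
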